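/-
Copyright (c) 2026 Gabriel Dahia. All rights reserved.
Released under Apache 2.0 license as described in the file LICENSE.
Authors: Gabriel Dahia

Ported into this library from `DensityHalesJewett/Subspace.lean` of
github.com/gdahia/DensityHalesJewett @ 27e0e64 (Apache-2.0): the namespace `DensityHalesJewett`
becomes `Literature.Combinatorics.HalesJewett`, module names are flattened and docstrings
carry provenance tags; the mathematics is unchanged.
-/
import Literature.Combinatorics.HalesJewett.SubspaceToolkit
import Mathlib.Data.Finset.Density
import Mathlib.Logic.Equiv.Fin.Basic
import HarnessLib

/-!
# Combinatorial subspaces: ranges, relative density, lines contained in a subspace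

Ranges, containment, relative density, alphabet restriction, and lines inside Mathlib's
`Combinatorics.Subspace`.

## Relation to `SubspaceToolkit.lean` (same directory)

The tree's `SubspaceToolkit.lean` already provides the DKT §2 dictionary on Mathlib's
`Combinatorics.Subspace`: composition `V.comp W` (`comp_apply`), the action on variable words
`V.pat w` and the line `V.line l` of a parameter-cube line (`line_apply`, `line_idxFun`,
`comp_pat`, `comp_line`), `V.injective`, change of alphabet `V.mapLetters f` and padding
`V.extend f a₀`. This file USES those (the upstream port's `compose` / `composeLine` / `mapLine` /
`injective`, definitionally equal to `comp` / `line` / `line` / `injective`, were deleted in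
favour of the toolkit's) and ADDS what the density argument needs on top:
* `range V` (the finite set of points of `V`), `IsContained V A`, `relativeDensity V A`
  (`dens_V(A)` of DKT §2, through `Finset.dens` of the parameter cube);
* `concat` (subspaces on disjoint coordinate blocks), `repeatInitial`, `lineToSubspaceFinOne`
  (Mathlib's `Line.toSubspaceUnit` reindexed along `Unit ≃ Fin 1`);
* the TYPE `Lines V` of ambient lines all of whose points lie in `range V` — the literal
  `Lines(V)` of DKT §2 — with `linesEquiv V : Line α η ≃ Lines V` (`l ↦ V.line l`; the inverse
  `uncomposeLine` needs `Nontrivial α`), so that `Lines(V) = {V.line l}`;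
* `restrictAlphabet V e` = `{V (e ∘ x)}`, the point set `V ↾ k'` of DKT §2 for an alphabet
  embedding `e : β ↪ α` (the toolkit's `mapLetters` is the complementary operation: it changes the
  CONSTANTS of a subspace along `α → α'`; `restrictAlphabet` restricts the values of the
  VARIABLES; the port uses `restrictAlphabet` with `e = Fin.castSuccEmb`).

## Source of the formalization

This file is a port (namespace, imports and docstring tags only; proofs unchanged) of the file
`DensityHalesJewett/Subspace.lean`
of the Apache-2.0 Lean 4 development github.com/gdahia/DensityHalesJewett @ 27e0e64 (G. Dahia 2026),
a formalization of Dodos–Kanellopoulos–Tyros, *A simple proof of the density Hales–Jewett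
theorem* (IMRN 2014).
Paper locators in the tags refer to that article (arXiv:1209.4986 numbering: Thm 1, Prop. 2–3,
Lemma 4, Cor. 5, Prop. 6, Lemmas 7–8, Def. 9, Lemma 10, Cor. 11, Lemma 12, Cor. 13).
Status (2026-08-15): of this port the tree holds `Word`, `Subspace`, `FiniteUnions`, `Canonization`,
`GrahamRothschild` and `Insensitive` (this directory). The density Hales–Jewett theorem itself was
completed in the tree by the parallel development `DKTSubspaces` / `DKTCorrelation` /
`DensityHalesJewettProofs` (`DensityHalesJewett_holds`; it builds on `Word.lean` and `Subspace.lean`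
of this port), and Szemerédi's theorem is discharged as
`Literature.Combinatorics.Additive.SzemerediTheorem_holds` in
`NumberTheory/Sieve/ParityWave0GreenTaoHolds.lean`; the remaining upstream files (`UniformFibers`,
the tilings of `Insensitive`, `DensityIncrement/…`, `Main`) were therefore not ported.

## References
* P. Dodos, V. Kanellopoulos, K. Tyros, *A simple proof of the density Hales–Jewett theorem*,
  IMRN 2014 (12), 3340–3352, arXiv:1209.4986. [cite: DodosKanellopoulosTyros2014]
* H. Furstenberg, Y. Katznelson, *A density version of the Hales–Jewett theorem*, J. Anal. Math. 57
  (1991), 64–119 — the theorem. [cite: FurstenbergKatznelson1991]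
* D. H. J. Polymath, *A new proof of the density Hales–Jewett theorem*, Ann. of Math. 175 (2012),
  1283–1327. [cite: Polymath2012DHJ]
-/

open Finset Function
open Combinatorics

namespace Literature.Combinatorics.HalesJewett
namespace Subspace

variable {η α ι θ κ : Type*}

/-- The finite range of a combinatorial subspace. [folklore] -/
def range [Fintype (η → α)] [DecidableEq (ι → α)]
    (V : Combinatorics.Subspace η α ι) : Finset (ι → α) :=
  Finset.univ.image V

/-- A word lies in the range of a subspace iff it is the image of some parameter word. [folklore] -/
@[simp]
lemma mem_range [Fintype (η → α)] [DecidableEq (ι → α)]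
    {V : Combinatorics.Subspace η α ι} {w : ι → α} :
    w ∈ range V ↔ ∃ x, V x = w := by
  simp [range]

/-- A subspace is contained in a finite word family when all its evaluations belong to it.
[folklore] -/
def IsContained (V : Combinatorics.Subspace η α ι) (A : Finset (ι → α)) : Prop :=
  ∀ x, V x ∈ A

/-- Repeat the first `m` parameter directions to fill a larger `M`-coordinate cube. [folklore] -/
def repeatInitial {m M : ℕ} (α : Type*) (hm : 1 ≤ m) (hmM : m ≤ M) :
    Combinatorics.Subspace (Fin m) α (Fin M) where
  idxFun i := Sum.inr <|
    if hi : i.val < m then ⟨i.val, hi⟩ else ⟨0, Nat.zero_lt_of_lt hm⟩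
  proper e := by
    refine ⟨Fin.castLE hmM e, ?_⟩
    simp only [Fin.castLE, e.isLt, ↓reduceDIte]

/-- `repeatInitial` commutes with relabelling the letters of the parameter word. [folklore] -/
@[simp]
lemma repeatInitial_map {β : Type*} {m M : ℕ} (α : Type*) (hm : 1 ≤ m) (hmM : m ≤ M)
    (f : β → α) (x : Fin m → β) :
    repeatInitial α hm hmM (f ∘ x) = f ∘ repeatInitial β hm hmM x := by
  funext i
  simp only [Function.comp_apply, (repeatInitial α hm hmM).apply_inr rfl,
    (repeatInitial β hm hmM).apply_inr rfl]

/-- Concatenate subspaces on disjoint coordinate blocks. [folklore] -/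
def concat (V : Combinatorics.Subspace η α ι) (W : Combinatorics.Subspace θ α κ) :
    Combinatorics.Subspace (η ⊕ θ) α (ι ⊕ κ) where
  idxFun := Sum.elim
    (fun i ↦ (V.idxFun i).elim Sum.inl (fun e ↦ Sum.inr <| Sum.inl e))
    (fun i ↦ (W.idxFun i).elim Sum.inl (fun e ↦ Sum.inr <| Sum.inr e))
  proper e := by
    cases e with
    | inl e =>
      obtain ⟨i, hi⟩ := V.proper e
      refine ⟨Sum.inl i, ?_⟩
      simp only [hi, Sum.elim_inl, Sum.elim_inr]
    | inr e =>
      obtain ⟨i, hi⟩ := W.proper e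
      refine ⟨Sum.inr i, ?_⟩
      simp only [hi, Sum.elim_inr]

/-- A concatenated subspace evaluates blockwise: `concat V W (Sum.elim x y) = Sum.elim (V x) (W y)`.
[folklore] -/
@[simp]
lemma concat_apply (V : Combinatorics.Subspace η α ι) (W : Combinatorics.Subspace θ α κ)
    (x : η → α) (y : θ → α) : concat V W (Sum.elim x y) =
      Sum.elim (V x) (W y) := by
  funext i
  cases i with
  | inl i => cases hi : V.idxFun i <;> simp [concat, Combinatorics.Subspace.coe_apply, hi]
  | inr i => cases hi : W.idxFun i <;> simp [concat, Combinatorics.Subspace.coe_apply, hi]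

/-- Regard a line as a one-dimensional subspace parameterized by `Fin 1`: Mathlib's
`Line.toSubspaceUnit`, reindexed along `Unit ≃ Fin 1`. [folklore] -/
def lineToSubspaceFinOne (l : Combinatorics.Line α ι) :
    Combinatorics.Subspace (Fin 1) α ι :=
  l.toSubspaceUnit.reindex finOneEquiv.symm (Equiv.refl _) (Equiv.refl _)

/-- The `Fin 1`-indexed subspace of a line evaluates as the line at the unique parameter.
[folklore] -/
@[simp]
lemma lineToSubspaceFinOne_apply (l : Combinatorics.Line α ι) (x : Fin 1 → α) :
    lineToSubspaceFinOne l x = l (x 0) := by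
  funext i
  simp [lineToSubspaceFinOne, Fin.eq_zero]

/-- Relative density on a subspace, defined on its parameter cube.
[cite: DodosKanellopoulosTyros2014, §2 (dens_V(A) = |A ∩ V| / |V|)] -/
def relativeDensity [Fintype (η → α)] [DecidableEq (ι → α)]
    (V : Combinatorics.Subspace η α ι) (A : Finset (ι → α)) : ℚ≥0 :=
  (Finset.univ.filter fun x ↦ V x ∈ A).dens

/-- Ambient line structures whose evaluations are contained in a subspace.
[cite: DodosKanellopoulosTyros2014, §2 (Lines(V))] -/
def Lines [Fintype (η → α)] [DecidableEq (ι → α)]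
    (V : Combinatorics.Subspace η α ι) :=
  {l : Combinatorics.Line α ι // ∀ a, l a ∈ range V}

/-- Regard the line `V.line l` of a parameter-cube line `l` (the toolkit's
`Combinatorics.Subspace.line`) as an element of `Lines V`. [folklore] -/
def composeLineToLines [Fintype (η → α)] [DecidableEq (ι → α)]
    (V : Combinatorics.Subspace η α ι) (l : Combinatorics.Line α η) : Lines V :=
  ⟨V.line l, fun a ↦ mem_range.mpr ⟨l a, (V.line_apply l a).symm⟩⟩

/-- The canonical parameter word representing a point of a line contained in a subspace.
[folklore] -/
noncomputable def parameterWord [Fintype (η → α)] [DecidableEq (ι → α)]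
    (V : Combinatorics.Subspace η α ι) (q : Lines V) (a : α) : η → α :=
  Classical.choose <| mem_range.mp (q.2 a)

/-- The chosen parameter word of a point of a contained line is mapped by the subspace to that
point. [folklore] -/
lemma parameterWord_apply [Fintype (η → α)] [DecidableEq (ι → α)]
    (V : Combinatorics.Subspace η α ι) (q : Lines V) (a : α) :
    V (parameterWord V q a) = q.1 a :=
  Classical.choose_spec <| mem_range.mp (q.2 a)

/-- A chosen coordinate on which a subspace realizes a given parameter direction. [folklore] -/
noncomputable def properCoordinate (V : Combinatorics.Subspace η α ι) (e : η) : ι :=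
  Classical.choose <| V.proper e

/-- The chosen coordinate indeed carries the given parameter direction. [folklore] -/
lemma properCoordinate_spec (V : Combinatorics.Subspace η α ι) (e : η) :
    V.idxFun (properCoordinate V e) = Sum.inr e :=
  Classical.choose_spec <| V.proper e

/-- Recover the parameter-cube line underlying an ambient line contained in a subspace.
[folklore] -/
noncomputable def uncomposeLine [Fintype (η → α)] [DecidableEq (ι → α)] [Nontrivial α]
    (V : Combinatorics.Subspace η α ι) (q : Lines V) : Combinatorics.Line α η where
  idxFun e := q.1.idxFun (properCoordinate V e)
  proper := by
    obtain ⟨j, hj⟩ := q.1.proper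
    cases hVj : V.idxFun j with
    | inl b =>
      obtain ⟨a, hab⟩ := exists_ne b
      refine absurd ?_ hab
      rw [← q.1.apply_none a j hj, ← parameterWord_apply V q a]
      exact V.apply_inl hVj
    | inr e =>
      cases hq : q.1.idxFun (properCoordinate V e) with
      | none => exact ⟨e, hq⟩
      | some c =>
        obtain ⟨a, hac⟩ := exists_ne c
        exact absurd (by rw [← q.1.apply_none a j hj, ← q.1.apply_some hq,
          ← parameterWord_apply V q a, V.apply_inr (properCoordinate_spec V e),
          V.apply_inr hVj]) hac

/-- The recovered parameter-cube line is mapped by the subspace onto the given ambient line,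
pointwise. [folklore] -/
lemma uncomposeLine_apply [Fintype (η → α)] [DecidableEq (ι → α)] [Nontrivial α]
    (V : Combinatorics.Subspace η α ι) (q : Lines V) (a : α) :
    V (uncomposeLine V q a) = q.1 a := by
  funext i
  cases hi : V.idxFun i with
  | inl b => rw [V.apply_inl hi, ← parameterWord_apply V q a, V.apply_inl hi]
  | inr e =>
    rw [V.apply_inr hi]
    change q.1 a (properCoordinate V e) = q.1 a i
    rw [← parameterWord_apply V q a, V.apply_inr (properCoordinate_spec V e), V.apply_inr hi]

/-- Composition with a subspace identifies parameter-cube lines with ambient lines contained in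
the subspace: `l ↦ V.line l` is a bijection `Line α η ≃ Lines V` (so `Lines(V) = {V.line l}`;
the inverse reads a line of `V` off the coordinates carrying the variables, `Nontrivial α` is
needed for it to be well defined). [folklore] -/
noncomputable def linesEquiv [Fintype (η → α)] [DecidableEq (ι → α)]
    [Nontrivial α] (V : Combinatorics.Subspace η α ι) :
    Combinatorics.Line α η ≃ Lines V where
  toFun := composeLineToLines V
  invFun := uncomposeLine V
  left_inv := by
    intro l
    apply Combinatorics.Line.coe_injective
    funext a
    apply V.injective
    rw [uncomposeLine_apply]
    exact V.line_apply l a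
  right_inv := by
    intro q
    apply Subtype.ext
    change V.line (uncomposeLine V q) = q.1
    apply Combinatorics.Line.coe_injective
    funext a
    rw [Combinatorics.Subspace.line_apply]
    exact uncomposeLine_apply V q a

/-- Restrict the variable letters of a subspace along an alphabet embedding: the point set
`{V (e ∘ x) : x : η → β}` — for `e : Fin k ↪ Fin (k+1)` this is `V ↾ k` of DKT §2. (Not the
toolkit's `mapLetters`, which pushes the constants of `V` along a map of alphabets.)
[cite: DodosKanellopoulosTyros2014, §2 (the restriction V↾k' to a sub-alphabet)] -/
def restrictAlphabet {β : Type*} [Fintype (η → β)] [DecidableEq (ι → α)]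
    (V : Combinatorics.Subspace η α ι) (e : β ↪ α) : Finset (ι → α) :=
  Finset.univ.image fun x ↦ V (e ∘ x)

end Subspace
end Literature.Combinatorics.HalesJewett
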